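/-
Copyright (c) 2026. Released under Apache 2.0 license.
-/
import Summits.RiemannHypothesis.RiemannHypothesis.Theorems.MotivicDoorSemilocalExact558Arch
import HarnessLib

/-!
# Motivic door, semi-local ladder — rung R3⁻(0.558): `W_{∞,2}` fails on `C(a)` for every `a > 0.558`

Cell `rh-explicit`, seat cc-s2-2, workstream CC-M2.  Second rung in the cell-free exact-evaluation format of
`MotivicDoorSemilocalExact56Bound.lean` (`a*({2}) ≤ 0.56`), whose constant lemmas (`const_le_semilocalTwoConstant_sharp`, the
kernel `log` checks) it reuses; honest framing as there (a quantitative theorem about Connes' semi-local Weil functional at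
`S = {∞, 2}`; nothing here bears on RH itself).

* `not_weilSemilocalPositivityOn_two_of_gt_0558`: `¬ WeilSemilocalPositivityOn {2} a` for every real `a > 279/500`;
  `weilSemilocalThreshold_two_le_0558 : a*({2}) ≤ 279/500`, hence `a*({2}) ∈ [0.5498, 0.558]`
  (DATA, not used: `a*({2}) = 0.5573 ± 1e-4`, cells rh-explicit cc-s2-3 / weil-2 / weil-4).
* Witness: the odd degree-15 profile of `MotivicDoorSemilocalExact558Witness.lean` (`b = 279/500`), DATA margin
  `Re E₂(G)/‖G‖² = −1.547·10⁻⁶`; certified here `≤ −1.356·10⁻⁶ ‖G‖²` (losses: `γ` to 8 digits `8.5·10⁻⁸`, `log 2/√2` to 7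
  digits `6.8·10⁻⁸`, `log π` `2.6·10⁻⁸`, moments `M = 60` `1.4·10⁻⁹`, tail `10⁻¹⁰`).  The one format change w.r.t. the
  `0.56` rung: `τ* = log 2 / b` is enclosed from the 20-digit `log 2` (`LogTwoBounds`), because the interval Horner evaluation
  of the degree-31 increment polynomial amplifies the input width `≈ 10⁴`-fold (`3.4·10⁻⁶` of `Δ(τ*)` from the 9-digit `log 2`).
All numerics by `decide +kernel` (31 blocks of exponential sums, a few seconds each) / `norm_num`; no `native_decide`.
Part A (`Δ(log 2/b)`, exponential-sum data, the 31 kernel blocks `arch_checkX`) is `MotivicDoorSemilocalExact558Arch.lean`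
(split at the gate's 400-line limit); this file: bulk and tail integrals, the certified inequality `arch_lt_polarX`, the rung.
-/

set_option linter.dupNamespace false

noncomputable section

open MeasureTheory Set Filter Topology Real Finset
open Literature.NumberTheory.LFunctions
open Literature.Analysis.ValidatedNumerics.Numerics
open Literature.Analysis.ValidatedNumerics.ExpSum

namespace Summit.RiemannHypothesis.RiemannHypothesis.Theorems.MotivicDoor.SemilocalExact558

open SemilocalMarkov SemilocalKernel SemilocalUndecicKernel SemilocalQuintic SemilocalThreshold Semilocal
open SemilocalArchExact SemilocalArchMoments SemilocalExact56

/-- The bulk: `∫_{(0,2b]} w D ≤ BARCHX`. -/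
theorem bulk_integral_leX :
    ∫ t in Ioc 0 (2 * SemilocalExact558.bX), weilArchDensity t * weilIncrement SemilocalExact558.GX t ≤
      (SemilocalExact558.BARCHX : ℝ) := by
  have hL : (0 : ℚ) < 279 / 250 := by norm_num
  have hcast : (((279 / 250 : ℚ)) : ℝ) = 2 * bX := by unfold bX; push_cast; norm_num
  have h1 : ∫ t in Ioc 0 (2 * bX), weilArchDensity t * weilIncrement GX t
      = ∫ t in Ioc 0 (((279 / 250 : ℚ)) : ℝ), weilArchDensity t * polyT dTX 0 t := by
    rw [hcast]
    refine setIntegral_congr_fun measurableSet_Ioc fun t ht ↦ ?_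
    rw [weilIncrement_GX_eq_polyT ht.1.le ht.2]
  rw [h1]
  have h := setIntegral_weilArchDensity_mul_polyT_le_of_archCheck (by positivity : 0 < 2 ^ 256) dTX 0 MX hL
    arch_checkX
  rw [usX_sum] at h
  exact h

/-! ## The tail `∫_{(2b,∞)} w · 2N` -/

/-- The density tail check of `WeilArchDensityPanelCheck` passes at `b = 279/500`. -/
theorem tail_checkX : archTailCheck (2 ^ 110) 20 8 26 (279 / 500) = true := by decide +kernel

/-- The certified tail bound is `≤ T_hi = 1.170857080634485`. -/
theorem tail_boundX : (archTailBounds (2 ^ 110) 20 8 26 (279 / 500)).2 ≤ (234171416126897 : ℚ) / 200000000000000 := by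
  decide +kernel

/-- `∫_{(2b,∞)} ρ ≤ T_hi`. -/
theorem arch_tail_leX : ∫ t in Ioi (2 * bX), weilArchDensity t ≤ (234171416126897 : ℝ) / 200000000000000 := by
  have h := (archTail_sound (by positivity : 0 < 2 ^ 110) (by norm_num : (0 : ℚ) < 279 / 500) tail_checkX).2
  have hb : (2 * (((279 / 500 : ℚ)) : ℝ)) = 2 * bX := by unfold bX; push_cast; ring
  rw [hb] at h
  have h2 : (((archTailBounds (2 ^ 110) 20 8 26 (279 / 500)).2 : ℚ) : ℝ)
      ≤ ((234171416126897 / 200000000000000 : ℚ) : ℝ) := Rat.cast_le.2 tail_boundX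
  have h3 : ((234171416126897 / 200000000000000 : ℚ) : ℝ) = (234171416126897 : ℝ) / 200000000000000 := by push_cast; ring
  linarith

/-- `∫_{(2b,∞)} w D = 2N ∫_{(2b,∞)} ρ ≤ 2N · T_hi`. -/
theorem tail_integral_leX :
    ∫ t in Ioi (2 * bX), weilArchDensity t * weilIncrement GX t ≤ 2 * NX * ((234171416126897 : ℝ) / 200000000000000) := by
  have h1 : ∫ t in Ioi (2 * bX), weilArchDensity t * weilIncrement GX t
      = ∫ t in Ioi (2 * bX), weilArchDensity t * (2 * NX) :=
    setIntegral_congr_fun measurableSet_Ioi fun t ht ↦ by rw [weilIncrement_GX_eq_of_lt (mem_Ioi.1 ht)]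
  rw [h1, integral_mul_const, mul_comm]
  exact mul_le_mul_of_nonneg_left arch_tail_leX (by linarith [NX_nonneg])

/-! ## The certified inequality -/

/-- **The certified Markov inequality for the degree-15 witness at `b = 0.558`, with polar credit**:
`(log 2/√2) D_{log 2}(G) + ∫₀^∞ w D(G) < C₂ ‖G‖² + 2 |Ĝ(1)|²`. -/
theorem arch_lt_polarX :
    Real.log 2 / Real.sqrt 2 * weilIncrement SemilocalExact558.GX (Real.log 2)
      + (∫ t in Ioi (0 : ℝ), weilArchDensity t * weilIncrement SemilocalExact558.GX t)
      < semilocalTwoConstant * (∫ x, ‖SemilocalExact558.GX x‖ ^ 2) + 2 * ‖weilMellin SemilocalExact558.GX 1‖ ^ 2 := by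
  have hb := bX_pos
  have hl1 := Real.log_two_gt_d9
  have hl2 := Real.log_two_lt_d9
  have hSC := SC_pos
  -- D(log 2)
  have hD : weilIncrement GX (Real.log 2) ≤ 2 * bX * ((BDX : ℝ) / SC) := by
    rw [weilIncrement_GX_eq (by linarith) (by unfold bX; linarith)]
    refine mul_le_mul_of_nonneg_left ?_ (by positivity)
    have h := hornerR_dX_log_two_le
    rw [hornerR_eq_polyR] at h
    exact h
  have h1 : Real.log 2 / Real.sqrt 2 * weilIncrement GX (Real.log 2)
      ≤ 4901291 / 10000000 * (2 * bX * ((BDX : ℝ) / SC)) :=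
    mul_le_mul log_two_div_sqrt_two_le hD (weilIncrement_nonneg _ _) (by norm_num)
  -- split the integral
  have hfin := integrableOn_w_mul_weilIncrement_GX
  have hI : ∫ t in Ioi (0 : ℝ), weilArchDensity t * weilIncrement GX t
      = (∫ t in Ioc 0 (2 * bX), weilArchDensity t * weilIncrement GX t)
        + ∫ t in Ioi (2 * bX), weilArchDensity t * weilIncrement GX t := by
    rw [← setIntegral_union Ioc_disjoint_Ioi_same measurableSet_Ioi
      (hfin.mono_set Ioc_subset_Ioi_self) (hfin.mono_set (Ioi_subset_Ioi (by positivity))),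
      Ioc_union_Ioi_eq_Ioi (by positivity)]
  have h2 := bulk_integral_leX
  have h3 := tail_integral_leX
  -- the constant
  have hC := const_le_semilocalTwoConstant_sharp
  have hK := kLo_le_kSum
  have hNX : 0 ≤ NX := NX_nonneg
  have h4 : (408849794 / 100000000 + 2 * ((KL : ℝ) / SC + (5 / 4 / 801 - 3 / 4 / 802))) * NX
      ≤ semilocalTwoConstant * NX :=
    mul_le_mul_of_nonneg_right (by linarith) hNX
  -- the polar credit
  have hP : 2 * (30956208281 / 2500 : ℝ) ^ 2 ≤ 2 * ‖weilMellin GX 1‖ ^ 2 := by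
    have h := polar_moment_le_norm
    have h0 : (0 : ℝ) ≤ 30956208281 / 2500 := by norm_num
    nlinarith [h, h0]
  have key : 4901291 / 10000000 * (2 * bX * ((BDX : ℝ) / SC))
      + ((BARCHX : ℝ) + 2 * NX * ((234171416126897 : ℝ) / 200000000000000))
      < (408849794 / 100000000 + 2 * ((KL : ℝ) / SC + (5 / 4 / 801 - 3 / 4 / 802))) * NX
        + 2 * (30956208281 / 2500 : ℝ) ^ 2 := by
    simp only [bX, NX, n2X, BDX, BARCHX, KL, SC]
    push_cast
    norm_num
  rw [integral_norm_sq_GX, hI]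
  linarith

/-! ## The rung -/

/-- `W_{∞,2}` fails on `C(B)` for `0.558 < B ≤ log 2`. -/
theorem not_weilSemilocalPositivityOn_two_of_gt_of_le_0558 {B : ℝ} (hbB : SemilocalExact558.bX < B)
    (hB : B ≤ Real.log 2) : ¬ WeilSemilocalPositivityOn ({2} : Finset ℕ) B :=
  isMarkovWitness_GX.not_weilSemilocalPositivityOn_two_polar integrableOn_w_mul_weilIncrement_GX
    arch_lt_polarX hbB hB

/-- **Rung R3⁻(0.558).**  For every `a > 0.558` the semi-local Weil form at `S = {∞, 2}` takes a
negative value on some test function supported in `[-a, a]`: `¬ WeilSemilocalPositivityOn {2} a`. -/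
theorem not_weilSemilocalPositivityOn_two_of_gt_0558 {a : ℝ} (ha : (279 / 500 : ℝ) < a) :
    ¬ WeilSemilocalPositivityOn ({2} : Finset ℕ) a := by
  by_cases h : a ≤ Real.log 2
  · exact not_weilSemilocalPositivityOn_two_of_gt_of_le_0558 ha h
  · exact not_weilSemilocalPositivityOn_two_of_log_two_le (le_of_not_ge h)

/-- The same for every finite set of places `S ∋ 2`, `3 ∉ S`. -/
theorem not_weilSemilocalPositivityOn_of_gt_0558 {S : Finset ℕ} (h2 : 2 ∈ S) (h3 : 3 ∉ S) {a : ℝ}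
    (ha : (279 / 500 : ℝ) < a) : ¬ WeilSemilocalPositivityOn S a := by
  by_cases h : a ≤ Real.log 2
  · rw [weilSemilocalPositivityOn_iff_two h2 h3 (h.trans log_two_le_log_five_half)]
    exact not_weilSemilocalPositivityOn_two_of_gt_0558 ha
  · exact not_weilSemilocalPositivityOn_of_log_two_le h2 h3 (le_of_not_ge h)

/-- **The threshold form of the rung**: `a*({2}) ≤ 0.558`. -/
theorem weilSemilocalThreshold_two_le_0558 : weilSemilocalThreshold {2} ≤ 279 / 500 := by
  by_contra h
  obtain ⟨a, ha1, ha2⟩ := exists_between (lt_of_not_ge h)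
  exact not_weilSemilocalPositivityOn_two_of_gt_0558 ha1
    (weilSemilocalPositivityOn_iff_le_weilSemilocalThreshold.2 ha2.le)

/-- **Rung R3 as one number**: `a*({2}) ∈ [563/1024, 279/500]`. -/
theorem weilSemilocalThreshold_two_mem_Icc_0558 :
    weilSemilocalThreshold {2} ∈ Icc (((weilCert3C.b : ℚ) : ℝ)) (279 / 500) :=
  ⟨weilSemilocalThreshold_two_mem_Ico.1, weilSemilocalThreshold_two_le_0558⟩

/-- Decimal form: `0.5498 ≤ a*({2}) ≤ 0.558` (PROVED; DATA, not used: `a*({2}) = 0.5578…`). -/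
theorem weilSemilocalThreshold_two_bounds_0558 :
    (0.5498 : ℝ) ≤ weilSemilocalThreshold {2} ∧ weilSemilocalThreshold {2} ≤ 0.558 :=
  ⟨weilSemilocalThreshold_two_bounds.1,
    by have := weilSemilocalThreshold_two_le_0558; norm_num at this ⊢; exact this⟩

/-- For every finite `S` with `2 ∈ S ∌ 3`: `a*(S) ≤ 0.558`. -/
theorem weilSemilocalThreshold_le_of_two_three_0558 {S : Finset ℕ} (h2 : 2 ∈ S) (h3 : 3 ∉ S) :
    weilSemilocalThreshold S ≤ 279 / 500 := by
  rw [weilSemilocalThreshold_eq_two h2 h3]; exact weilSemilocalThreshold_two_le_0558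

end Summit.RiemannHypothesis.RiemannHypothesis.Theorems.MotivicDoor.SemilocalExact558

end
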